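import Mathlib
import Literature.NumberTheory.Transcendental.KZSemialgebraicComplex
import Literature.NumberTheory.Transcendental.SemialgebraicMapsProofs
import Summits.KontsevichZagierPeriods.KontsevichZagierPeriods.Theorems.SoloInformedKZBounded
import HarnessLib

/-!
# SoloInformed — every integral representation lives on the unit cube

**THEOREM B′** (`soloInformed_kzUnitCube`): every integral representation `r` on `ℝⁿ` is
equivalent under the Kontsevich–Zagier moves, with multiplicity one, to the sum of `3ⁿ`
representations whose domain *is* the unit cube `[0,1]ⁿ` (with `ℚ`-semialgebraic, integrable,
possibly discontinuous integrands). Three moves on top of THEOREM B (`soloInformed_kzBounded`,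
domains inside `[-1,1]ⁿ`):

* the affine change of variables `y ↦ (y + 1)/2` (rule (2), Jacobian `2⁻ⁿ`) moves `[-1,1]ⁿ` onto
  `[0,1]ⁿ` (`soloInformed_halfRep_mem_relations`);
* zero extension `[D, f] ≡ [[0,1]ⁿ, 1_D · f]` for `D ⊆ [0,1]ⁿ` (rule (1) with the pieces `D` and
  `[0,1]ⁿ \ D`; the zero extension is `ℚ`-semialgebraic because its graph is the union of the graph
  of `f` over `D` and of `0` over the complement, `soloInformed_extendRep_mem_relations`);
* a representation with vanishing integrand is itself a relation (rule (1b) with `0 = 0 + 0`,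
  `soloInformed_of_mem_relations_of_integrand_zero`).

Consequently the open resolution statement `SoloInformedAyoubCubeResolution` need only be proved
for representations `[[0,1]ⁿ, f]`.
References: Kontsevich–Zagier 2001, §1.2 rules (1)–(2); Bochnak–Coste–Roy 1998, §2.2.
-/

noncomputable section

open scoped BigOperators
open MeasureTheory Set MvPolynomial
open Literature.NumberTheory.Transcendental Literature.NumberTheory.Transcendental.KZ
open Literature.ModelTheory.ExponentialFields (IsSemialgebraic)

namespace Summit.KontsevichZagierPeriods.KontsevichZagierPeriods.Theorems

variable {n : ℕ}

/-! ### Zero extension -/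

/-- The zero extension to `S ⊇ D` of a `ℚ`-semialgebraic function on `D` is `ℚ`-semialgebraic:
its graph is the union of two semialgebraic graphs. [BCR 1998, Def. 2.2.5] -/
theorem soloInformed_isSemialgebraicFunOn_indicator {S D : Set (Fin n → ℝ)}
    {f : (Fin n → ℝ) → ℝ} (hS : IsSemialgebraic ℚ S) (hD : IsSemialgebraic ℚ D) (hDS : D ⊆ S)
    (hf : IsSemialgebraicFunOn ℚ D f) : IsSemialgebraicFunOn ℚ S (D.indicator f) := by
  have h0 : IsSemialgebraicFunOn ℚ (S \ D) (fun _ => (0 : ℝ)) :=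
    (isSemialgebraicFunOn_aeval (hS.diff hD) (0 : MvPolynomial (Fin n) ℚ)).congr
      fun x _ => by simp
  unfold IsSemialgebraicFunOn at hf h0 ⊢
  convert hf.union h0 using 1
  ext z
  simp only [mem_setOf_eq, mem_union]
  constructor
  · rintro ⟨x, hx, rfl⟩
    by_cases hxD : x ∈ D
    · exact Or.inl ⟨x, hxD, by rw [indicator_of_mem hxD]⟩
    · exact Or.inr ⟨x, ⟨hx, hxD⟩, by rw [indicator_of_notMem hxD]⟩
  · rintro (⟨x, hx, rfl⟩ | ⟨x, hx, rfl⟩)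
    · exact ⟨x, hDS hx, by rw [indicator_of_mem hx]⟩
    · exact ⟨x, hx.1, by rw [indicator_of_notMem hx.2]⟩

/-- **Zero extension** of a representation `s` to a `ℚ`-semialgebraic set `S ⊇ s.domain`:
domain `S`, integrand `1_{s.domain} · s.integrand`. -/
def soloInformedExtendRep (s : IntegralRep n) (S : Set (Fin n → ℝ)) (hS : IsSemialgebraic ℚ S)
    (hsub : s.domain ⊆ S) : IntegralRep n where
  domain := S
  integrand := s.domain.indicator s.integrand
  isSemialgebraic_domain := hS
  isSemialgebraicFunOn_integrand :=
    soloInformed_isSemialgebraicFunOn_indicator hS s.isSemialgebraic_domain hsub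
      s.isSemialgebraicFunOn_integrand
  integrableOn :=
    ((integrable_indicator_iff
      (IsSemialgebraic.measurableSet_holds s.isSemialgebraic_domain)).2 s.integrableOn).integrableOn

/-- A representation whose integrand vanishes on its domain is a relation
(rule (1b) with `0 = 0 + 0`). [Kontsevich–Zagier 2001, §1.2 rule (1)] -/
theorem soloInformed_of_mem_relations_of_integrand_zero (z : IntegralRep n)
    (hz : ∀ x ∈ z.domain, z.integrand x = 0) : of z ∈ relations := by
  have h : of z - of z - of z ∈ relations :=
    integrandAddRel_subset_relations ⟨n, z, z, z, rfl, rfl, fun x hx => by simp [hz x hx], rfl⟩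
  have he : of z - of z - of z = -of z := by abel
  rw [he] at h
  exact neg_mem_iff.1 h

/-- **Zero extension is a KZ move**: `[S, 1_D f] − [D, f] ∈ KZ.relations`.
[Kontsevich–Zagier 2001, §1.2 rule (1)] -/
theorem soloInformed_extendRep_mem_relations (s : IntegralRep n) (S : Set (Fin n → ℝ))
    (hS : IsSemialgebraic ℚ S) (hsub : s.domain ⊆ S) :
    of (soloInformedExtendRep s S hS hsub) - of s ∈ relations := by
  set e := soloInformedExtendRep s S hS hsub with he
  set z : IntegralRep n :=
    e.restrict (S \ s.domain) (hS.diff s.isSemialgebraic_domain) (fun _ hx => hx.1) with hz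
  have h1 : of e - of s - of z ∈ relations := by
    refine domainAddRel_subset_relations ⟨n, e, s, z, ?_, ?_, ?_, ?_, rfl⟩
    · ext x
      refine ⟨fun hx => ?_, ?_⟩
      · by_cases hD : x ∈ s.domain
        exacts [Or.inl hD, Or.inr ⟨hx, hD⟩]
      · rintro (hx | hx)
        exacts [hsub hx, hx.1]
    · rw [hz, IntegralRep.domain_restrict, inter_sdiff_self]
      exact measure_empty
    · exact fun x hx => indicator_of_mem hx _
    · exact fun _ _ => rfl
  have h2 : of z ∈ relations :=
    soloInformed_of_mem_relations_of_integrand_zero z fun x hx => indicator_of_notMem hx.2 _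
  have he' : of e - of s = (of e - of s - of z) + of z := by abel
  rw [he']
  exact relations.add_mem h1 h2

/-! ### The affine normalisation `[-1,1]ⁿ → [0,1]ⁿ` -/

/-- `H y = (y + 1)/2`, coordinatewise. -/
def soloInformedHalfMap (y : Fin n → ℝ) : Fin n → ℝ := fun i => (y i + 1) / 2

/-- Its inverse `z ↦ 2z − 1`. -/
def soloInformedDoubleMap (z : Fin n → ℝ) : Fin n → ℝ := fun i => 2 * z i - 1

/-- `H` as scaling plus translation. -/
theorem soloInformedHalfMap_eq :
    (soloInformedHalfMap : (Fin n → ℝ) → Fin n → ℝ) = fun y => (2⁻¹ : ℝ) • y + fun _ => 2⁻¹ := by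
  funext y
  ext i
  simp only [soloInformedHalfMap, Pi.add_apply, Pi.smul_apply, smul_eq_mul]
  ring

/-- `2 H(y) − 1 = y`. -/
theorem soloInformedDoubleMap_halfMap (y : Fin n → ℝ) :
    soloInformedDoubleMap (soloInformedHalfMap y) = y := by
  funext i
  simp only [soloInformedHalfMap, soloInformedDoubleMap]
  ring

/-- `H` is injective. -/
theorem soloInformedHalfMap_injective :
    Function.Injective (soloInformedHalfMap : (Fin n → ℝ) → Fin n → ℝ) :=
  Function.LeftInverse.injective soloInformedDoubleMap_halfMap

/-- `H` has derivative `2⁻¹ • id`. -/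
theorem soloInformed_hasFDerivWithinAt_halfMap (s : Set (Fin n → ℝ)) (x : Fin n → ℝ) :
    HasFDerivWithinAt soloInformedHalfMap ((2⁻¹ : ℝ) • ContinuousLinearMap.id ℝ (Fin n → ℝ))
      s x := by
  rw [soloInformedHalfMap_eq]
  exact (((ContinuousLinearMap.id ℝ (Fin n → ℝ)).hasFDerivWithinAt).const_smul
    (2⁻¹ : ℝ)).add_const _

/-- `|det (2⁻¹ • id)| = 2⁻ⁿ`. -/
theorem soloInformed_abs_det_half (n : ℕ) :
    |((2⁻¹ : ℝ) • ContinuousLinearMap.id ℝ (Fin n → ℝ)).det| = (2⁻¹ : ℝ) ^ n := by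
  rw [ContinuousLinearMap.det, ContinuousLinearMap.toLinearMap_smul, ContinuousLinearMap.coe_id,
    LinearMap.det_smul, LinearMap.det_id, mul_one, Module.finrank_fintype_fun_eq_card,
    Fintype.card_fin]
  exact abs_of_nonneg (by positivity)

/-- `H` is a polynomial map over `ℚ`, hence `ℚ`-semialgebraic. [BCR 1998, §2.2] -/
theorem soloInformed_isSemialgebraicMapOn_halfMap {s : Set (Fin n → ℝ)}
    (hs : IsSemialgebraic ℚ s) : IsSemialgebraicMapOn ℚ s soloInformedHalfMap := by
  refine (isSemialgebraicMapOn_aeval (R := ℝ) hs fun l : Fin n =>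
    MvPolynomial.C ((1 : ℚ) / 2) * (MvPolynomial.X l + MvPolynomial.C 1)).congr fun x _ => ?_
  ext l
  simp only [soloInformedHalfMap, map_add, map_mul, map_one, MvPolynomial.aeval_C,
    MvPolynomial.aeval_X, eq_ratCast]
  push_cast
  ring

/-- `z ↦ 2z − 1` is a polynomial map over `ℚ`, hence `ℚ`-semialgebraic. [BCR 1998, §2.2] -/
theorem soloInformed_isSemialgebraicMapOn_doubleMap {s : Set (Fin n → ℝ)}
    (hs : IsSemialgebraic ℚ s) : IsSemialgebraicMapOn ℚ s soloInformedDoubleMap := by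
  refine (isSemialgebraicMapOn_aeval (R := ℝ) hs fun l : Fin n =>
    MvPolynomial.C (2 : ℚ) * MvPolynomial.X l - MvPolynomial.C 1).congr fun x _ => ?_
  ext l
  simp only [soloInformedDoubleMap, map_sub, map_mul, map_one, MvPolynomial.aeval_C,
    MvPolynomial.aeval_X, eq_ratCast]
  push_cast
  ring

/-- `H` maps `[-1,1]ⁿ` into `[0,1]ⁿ`. -/
theorem soloInformed_halfMap_mem_cube {y : Fin n → ℝ} (hy : ∀ i, -1 ≤ y i ∧ y i ≤ 1) :
    soloInformedHalfMap y ∈ soloInformedCube n := by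
  rw [soloInformed_mem_cube_iff]
  intro i
  obtain ⟨h1, h2⟩ := hy i
  simp only [soloInformedHalfMap]
  constructor
  · linarith
  · linarith

/-- **The normalised representation** `H_* s`: domain `H '' s.domain`, integrand
`z ↦ s.integrand (2z − 1) · 2ⁿ`. [BCR 1998, Prop. 2.2.6–2.2.7] -/
def soloInformedHalfRep (s : IntegralRep n) : IntegralRep n where
  domain := soloInformedHalfMap '' s.domain
  integrand z := s.integrand (soloInformedDoubleMap z) * 2 ^ n
  isSemialgebraic_domain :=
    IsSemialgebraicMapOn.isSemialgebraic_image_holds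
      (soloInformed_isSemialgebraicMapOn_halfMap s.isSemialgebraic_domain) Subset.rfl
      s.isSemialgebraic_domain
  isSemialgebraicFunOn_integrand := by
    have hS : IsSemialgebraic ℚ (soloInformedHalfMap '' s.domain) :=
      IsSemialgebraicMapOn.isSemialgebraic_image_holds
        (soloInformed_isSemialgebraicMapOn_halfMap s.isSemialgebraic_domain) Subset.rfl
        s.isSemialgebraic_domain
    have hmaps : MapsTo soloInformedDoubleMap (soloInformedHalfMap '' s.domain) s.domain := by
      rintro _ ⟨x, hx, rfl⟩
      rw [soloInformedDoubleMap_halfMap]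
      exact hx
    have hcomp := IsSemialgebraicFunOn.comp_isSemialgebraicMapOn_holds
      s.isSemialgebraicFunOn_integrand (soloInformed_isSemialgebraicMapOn_doubleMap hS) hmaps
    have hc : IsSemialgebraicFunOn ℚ (soloInformedHalfMap '' s.domain) (fun _ => (2 : ℝ) ^ n) :=
      (isSemialgebraicFunOn_aeval hS (MvPolynomial.C ((2 : ℚ) ^ n))).congr fun x _ => by simp
    exact IsSemialgebraicFunOn.mul_holds hcomp hc
  integrableOn := by
    have hDm : MeasurableSet s.domain :=
      IsSemialgebraic.measurableSet_holds s.isSemialgebraic_domain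
    rw [integrableOn_image_iff_integrableOn_abs_det_fderiv_smul volume hDm
      (fun x _ => soloInformed_hasFDerivWithinAt_halfMap s.domain x)
      soloInformedHalfMap_injective.injOn]
    refine s.integrableOn.congr_fun (fun x _ => ?_) hDm
    rw [soloInformed_abs_det_half, soloInformedDoubleMap_halfMap, smul_eq_mul]
    have h2 : (2⁻¹ : ℝ) ^ n * 2 ^ n = 1 := by rw [← mul_pow]; norm_num
    calc s.integrand x = s.integrand x * ((2⁻¹ : ℝ) ^ n * 2 ^ n) := by rw [h2, mul_one]
      _ = (2⁻¹ : ℝ) ^ n * (s.integrand x * 2 ^ n) := by ring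

/-- **Normalisation is a KZ move**: `[s] − [H_* s] ∈ KZ.relations` (rule (2) with `Φ = H`).
[Kontsevich–Zagier 2001, §1.2 rule (2)] -/
theorem soloInformed_halfRep_mem_relations (s : IntegralRep n) :
    of s - of (soloInformedHalfRep s) ∈ relations := by
  refine changeOfVariablesRel_subset_relations ⟨n, s, soloInformedHalfRep s, soloInformedHalfMap,
    fun _ => (2⁻¹ : ℝ) • ContinuousLinearMap.id ℝ (Fin n → ℝ),
    soloInformed_isSemialgebraicMapOn_halfMap s.isSemialgebraic_domain,
    fun x _ => soloInformed_hasFDerivWithinAt_halfMap s.domain x,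
    soloInformedHalfMap_injective.injOn, rfl, fun x _ => ?_, rfl⟩
  show s.integrand x = s.integrand (soloInformedDoubleMap (soloInformedHalfMap x)) * 2 ^ n *
    |((2⁻¹ : ℝ) • ContinuousLinearMap.id ℝ (Fin n → ℝ)).det|
  rw [soloInformedDoubleMap_halfMap, soloInformed_abs_det_half, mul_assoc, ← mul_pow]
  norm_num

/-- `H_* s` has domain inside `[0,1]ⁿ` when `s` has domain inside `[-1,1]ⁿ`. -/
theorem soloInformed_halfRep_domain_subset (s : IntegralRep n)
    (hs : s.domain ⊆ {y : Fin n → ℝ | ∀ i, -1 ≤ y i ∧ y i ≤ 1}) :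
    (soloInformedHalfRep s).domain ⊆ soloInformedCube n := by
  rintro _ ⟨y, hy, rfl⟩
  exact soloInformed_halfMap_mem_cube (hs hy)

/-! ### THEOREM B′ -/

/-- The cube normalisation of a representation with domain inside `[-1,1]ⁿ`: normalise by `H`,
then extend by zero to the whole unit cube. -/
def soloInformedCubeNormRep (s : IntegralRep n)
    (hs : s.domain ⊆ {y : Fin n → ℝ | ∀ i, -1 ≤ y i ∧ y i ≤ 1}) : IntegralRep n :=
  soloInformedExtendRep (soloInformedHalfRep s) (soloInformedCube n)
    (isSemialgebraic_soloInformedCube n) (soloInformed_halfRep_domain_subset s hs)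

/-- The cube normalisation has domain `[0,1]ⁿ`. -/
@[simp] theorem soloInformedCubeNormRep_domain (s : IntegralRep n)
    (hs : s.domain ⊆ {y : Fin n → ℝ | ∀ i, -1 ≤ y i ∧ y i ≤ 1}) :
    (soloInformedCubeNormRep s hs).domain = soloInformedCube n := rfl

/-- The cube normalisation is a KZ move: `[s] − [norm s] ∈ KZ.relations`. -/
theorem soloInformed_cubeNormRep_mem_relations (s : IntegralRep n)
    (hs : s.domain ⊆ {y : Fin n → ℝ | ∀ i, -1 ≤ y i ∧ y i ≤ 1}) :
    of s - of (soloInformedCubeNormRep s hs) ∈ relations := by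
  have h1 := soloInformed_halfRep_mem_relations s
  have h2 := soloInformed_extendRep_mem_relations (soloInformedHalfRep s) (soloInformedCube n)
    (isSemialgebraic_soloInformedCube n) (soloInformed_halfRep_domain_subset s hs)
  have he : of s - of (soloInformedCubeNormRep s hs) = (of s - of (soloInformedHalfRep s)) -
      (of (soloInformedCubeNormRep s hs) - of (soloInformedHalfRep s)) := by abel
  rw [he]
  exact relations.sub_mem h1 h2

/-- **THEOREM B′ (every integral representation lives on the unit cube).** Every integral
representation is equivalent under the KZ moves, with multiplicity one, to the sum of finitely
many (`3ⁿ`) representations whose domain is the unit cube `[0,1]ⁿ`.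
[Kontsevich–Zagier 2001, §1.2 rules (1), (2)] -/
theorem soloInformed_kzUnitCube (r : IntegralRep n) :
    ∃ (m : ℕ) (rs : Fin m → IntegralRep n),
      (∀ k, (rs k).domain = soloInformedCube n) ∧ of r - ∑ k, of (rs k) ∈ relations := by
  obtain ⟨m, rs, hdom, hrel⟩ := soloInformed_kzBounded r
  refine ⟨m, fun k => soloInformedCubeNormRep (rs k) (hdom k), fun k => rfl, ?_⟩
  have heq : of r - ∑ k, of (soloInformedCubeNormRep (rs k) (hdom k)) =
      (of r - ∑ k, of (rs k)) +
        ∑ k, (of (rs k) - of (soloInformedCubeNormRep (rs k) (hdom k))) := by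
    rw [Finset.sum_sub_distrib]
    abel
  rw [heq]
  exact relations.add_mem hrel
    (relations.sum_mem fun k _ => soloInformed_cubeNormRep_mem_relations (rs k) (hdom k))

/-- **Corollary (two representations at once).** Two integral representations with equal values
are simultaneously equivalent to cube sums; in particular the Kontsevich–Zagier period conjecture
is equivalent to its restriction to formal differences of representations on the unit cube:
if `∑ₖ [rs k] − ∑ₖ [rs' k] ∈ KZ.relations` whenever all domains are `[0,1]ⁿ` and the values agree,
then `KZ.Equivalent r r'`. -/
theorem soloInformed_equivalent_of_cube_sums {r r' : IntegralRep n} {m m' : ℕ}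
    {rs : Fin m → IntegralRep n} {rs' : Fin m' → IntegralRep n}
    (hr : of r - ∑ k, of (rs k) ∈ relations) (hr' : of r' - ∑ k, of (rs' k) ∈ relations)
    (h : ∑ k, of (rs k) - ∑ k, of (rs' k) ∈ relations) : Equivalent r r' := by
  show of r - of r' ∈ relations
  have he : of r - of r' =
      (of r - ∑ k, of (rs k)) - (of r' - ∑ k, of (rs' k)) + (∑ k, of (rs k) - ∑ k, of (rs' k)) := by
    abel
  rw [he]
  exact relations.add_mem (relations.sub_mem hr hr') h

end Summit.KontsevichZagierPeriods.KontsevichZagierPeriods.Theorems
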